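import Summits.SmoothPoincare4.SmoothPoincare4.Theses.SullivanDual
import Literature.Topology.FourManifolds.HomotopyS4CompactProofs
import Literature.Topology.FourManifolds.HomotopyS4OrientableProofs

/-!
# SmoothPoincare4 / SullivanDual — the shared reduction to `HomotopySphere 4`

Settles item stmt-SmoothPoincare4-0374 (`Spc4ReductionHomotopySphere`, support of route
SullivanDual, shared verbatim with the sibling geometric routes): if every
`Literature.Topology.FourManifolds.HomotopySphere 4` is diffeomorphic to the round `S⁴`, then
`SmoothPoincare4`.

Bookkeeping only. `SmoothPoincare4` quantifies over bare Hausdorff second-countable `C^∞`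
4-manifolds `M` with a homotopy equivalence `e : M ≃ₕ S⁴`; such an `M` is compact (`H₄ ≠ 0`
forces compactness, Hatcher 2002 Prop. 3.29 / Cor. 2.14 — the proved tree theorem
`Literature.Topology.FourManifolds.compactSpace_of_homotopyEquiv_sphere_four_holds`) and simply
connected hence smoothly orientable (Lee 2013 Thm. 15.43 — the proved tree theorem
`Literature.Topology.FourManifolds.isOrientable_of_homotopyEquiv_sphere_four_holds`), so it
packages as a `HomotopySphere 4` with a chosen orientation, and the hypothesis applies.
No named-fact hypothesis remains: both packaging facts are discharged in tree.
-/

namespace Summit.SmoothPoincare4.SmoothPoincare4.Theorems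

open Summit.SmoothPoincare4.SmoothPoincare4.Theses.SullivanDual

/-- Settles stmt-SmoothPoincare4-0374: (every `HomotopySphere 4` is diffeomorphic to `S⁴`) →
`SmoothPoincare4`. Proof: unfold the problem statement to a bare `C^∞` 4-manifold `M` with
`e : M ≃ₕ S⁴`; `M` is compact (`compactSpace_of_homotopyEquiv_sphere_four_holds`, Hatcher
Prop. 3.29) and orientable (`isOrientable_of_homotopyEquiv_sphere_four_holds`, Lee Thm. 15.43);
package `⟨M, o, ⟨e⟩⟩ : HomotopySphere 4` and apply the hypothesis. [folklore] -/
theorem spc4ReductionHomotopySphere_proof :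
    Summit.SmoothPoincare4.SmoothPoincare4.Theses.SullivanDual.Spc4ReductionHomotopySphere := by
  unfold Spc4ReductionHomotopySphere
  intro hS
  unfold _root_.SmoothPoincare4 Literature.SPC4.SmoothPoincareConjectureFour
    ContinuousMap.HomotopyEquiv.NonemptyDiffeomorphSphere
  intro M _ _ _ _ _ e
  haveI : CompactSpace M :=
    Literature.Topology.FourManifolds.compactSpace_of_homotopyEquiv_sphere_four_holds M e
  obtain ⟨o⟩ :=
    Literature.Topology.FourManifolds.isOrientable_of_homotopyEquiv_sphere_four_holds M e
  exact hS ⟨M, o, ⟨e⟩⟩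

end Summit.SmoothPoincare4.SmoothPoincare4.Theorems
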